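import Literature.NumberTheory.PAdicHodge.DeRhamOfTatePtPeriods
import Literature.NumberTheory.PAdicHodge.AinfWeierstrassOmegaPeriodNonvanishing
import Literature.NumberTheory.PAdicHodge.AinfWeierstrassEtaHasseCriterion
import HarnessLib

/-!
# `V_pE` is de Rham at good SUPERSINGULAR reduction (`p ≥ 5`), modulo the η-Hasse congruence only

Topic `Literature/NumberTheory/PAdicHodge`; namespace `Literature.NumberTheory.PAdicHodge`. THEOREMS ONLY (no definition, no named
fact, no instance, no `sorry`).

Final assembly of the `p`-adic period road (Fontaine 1982 §5, Colmez 1992 §2) to Fontaine's theorem "`V_pE` is de Rham" for an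
elliptic curve with a `ℤ`-model `W` having good supersingular reduction at `p ≥ 5`, over any `p`-adic field `F` (BSD route
EdixhovenFibreFiveSeven, crux K★ `StarredOptimalManinUnitFiveSeven`, hDR|ss; memos `Lines/kato-lever-hDR-sector-iii-*.md`):

* the socket `isDeRham_rationalTateRep_curveF_of_tatePtPeriods` (file `DeRhamOfTatePtPeriods`) needs the witnesses
  (N1) `∃ τ, ∫_τ ω ≠ 0` and (Nη) `∃ τ, R_p(u₁) ∉ p𝒪_{ℂ_F}`;
* (N1) is the tree theorem `AinfTop.omegaPeriodHom_ne_zero_of_seq_one_not_mem` (file `AinfWeierstrassOmegaPeriodNonvanishing`) at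
  the point `τ` of `AinfTop.exists_tatePt_norm_p_lt_norm_pow` (`‖p‖ < ‖u₁‖^p`, file `AinfWeierstrassSupersingularTorsion`);
* (Nη) at the same point is the η-Hasse criterion `AinfTop.mulDefectC_not_mem_span_of_etaHasse` (file
  `AinfWeierstrassEtaHasseCriterion`) GIVEN the **η-Hasse congruence** for the integral series `R_p = mulDefectInt W p ∈ ℤ⟦X⟧`:
  `p ∣ [X^j]R_p` for `j < p` and `p ∤ [X^p]R_p` — a computable condition on the equation `W` (verified symbolically on the
  supersingular `ℤ`-models `y² = x³ + 1` at `p = 5` and `y² = x³ + x` at `p = 7`, memo `…-eta.md` §8; the general statement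
  "the η-Hasse invariant is a unit at supersingular reduction" is NOT proved here).

Results: `isDeRham_rationalTateRep_curveF_of_etaHasse` (curve `W ×_ℤ F` over `F`) and
`isDeRham_restrictedRationalTateRep_of_etaHasse` (a curve over a subfield `K₀ ⊆ F` whose base change is `W ×_ℤ F`, the currency of
the cite-only fact `isDeRham_restrictedRationalTateRep`). NOT covered: K★'s additive cells (need the good model over a RAMIFIED
`𝒪_{F'}`, road item (R1)), `p ≤ 3`. BSD is not proved by any of this; `isDeRham_restrictedRationalTateRep` stays cite-only.

## References
* [Fontaine1982FormesDifferentielles] J.-M. Fontaine, Invent. Math. 65 (1982), §5.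
* [Colmez1992PeriodesAbeliennes] P. Colmez, Math. Ann. 292 (1992), §2.
* [FontaineAsterisque223III] J.-M. Fontaine, Astérisque 223 (1994), Exp. III §1.5.
* [Tate1967] J. Tate, *p-divisible groups* (1967), §4.
-/

noncomputable section

namespace Literature.NumberTheory.PAdicHodge

open Literature Literature.NumberTheory.GaloisRepresentations Literature.NumberTheory.EllipticCurves WeierstrassCurve
open Literature.NumberTheory.GaloisRepresentations.IsNonarchimedeanLocalField Field ValuativeRel
open Literature.NumberTheory.GaloisRepresentations.LubinTate

variable {F : Type} [Field F] [ValuativeRel F] [TopologicalSpace F] [IsNonarchimedeanLocalField F] [CharZero F]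
  {p : ℕ} [Fact p.Prime] [Fact (¬ IsUnit (p : integerC F))] [IsAdicComplete (Ideal.span {(p : integerC F)}) (integerC F)]
  (hp : valuation F p < 1) [Algebra ℚ_[p] F]

/-- **`V_p(W ×_ℤ F)` is de Rham at good supersingular reduction, modulo the η-Hasse congruence.** Let `W/ℤ` be an integral
Weierstrass equation and `p ≥ 5` a prime with `p ∤ Δ_W` and `A_p(W mod p) = 0`; assume the η-Hasse congruence `p ∣ [X^j]R_p` (`j < p`),
`p ∤ [X^p]R_p` for `R_p = mulDefectInt W p`. Then for every `p`-adic field `F` (any `ℚ_p`-algebra structure) the representation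
`rationalTateRep (curveF F W) p` is de Rham for Fontaine's `bdRPeriodRingData hp`: both witnesses of
`isDeRham_rationalTateRep_curveF_of_tatePtPeriods` are supplied by a Tate-module point with `‖p‖ < ‖u₁‖^p`
(`exists_tatePt_norm_p_lt_norm_pow`): (N1) `omegaPeriodHom_ne_zero_of_seq_one_not_mem`, (Nη) `mulDefectC_not_mem_span_of_etaHasse`.
[cite: Fontaine1982FormesDifferentielles, §5] [cite: Colmez1992PeriodesAbeliennes, §2] [cite: Tate1967, §4] -/
theorem isDeRham_rationalTateRep_curveF_of_etaHasse (W : WeierstrassCurve ℤ) [(AinfTop.curveF F W).IsElliptic]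
    (hp5 : 5 ≤ p) (hΔ : ¬ (p : ℤ) ∣ W.Δ) (hA : (W.map (Int.castRingHom (ZMod p))).hasseCoeff p = 0)
    (hlow : ∀ j, j < p → (p : ℤ) ∣ PowerSeries.coeff j (AinfTop.mulDefectInt W p))
    (htop : ¬ (p : ℤ) ∣ PowerSeries.coeff p (AinfTop.mulDefectInt W p)) :
    GaloisRep.IsDeRham (bdRPeriodRingData (F := F) (p := p) hp) (rationalTateRep (AinfTop.curveF F W) p) := by
  have hp2 : p ≠ 2 := by omega
  obtain ⟨τ, hτ1, hτp⟩ := AinfTop.exists_tatePt_norm_p_lt_norm_pow F p W hp2 hΔ hA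
  exact isDeRham_rationalTateRep_curveF_of_tatePtPeriods hp W hp2 hΔ hA
    ⟨τ, AinfTop.omegaPeriodHom_ne_zero_of_seq_one_not_mem W hp5 hΔ hA τ
      (AinfTop.not_mem_span_of_norm_p_lt_norm_pow _ hτp)⟩
    ⟨τ, AinfTop.mulDefectC_not_mem_span_of_etaHasse W hlow htop (AinfTop.seq W τ 1)
      (AinfTop.pow_not_mem_span_of_norm_lt _ hτ1 hτp)⟩

/-- **The same for a curve over a subfield `K₀ ⊆ F` whose base change to `F` is `W ×_ℤ F`** (e.g. `K₀ = ℚ`, `W₀ = W ×_ℤ ℚ`), in the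
currency `restrictedRationalTateRep` of the cite-only fact `isDeRham_restrictedRationalTateRep`: hDR for every elliptic curve over a
subfield of `F` admitting a `ℤ`-model with good supersingular reduction at `p ≥ 5` satisfying the η-Hasse congruence. BSD is not proved
by this. [cite: Fontaine1982FormesDifferentielles, §5] [cite: Colmez1992PeriodesAbeliennes, §2] -/
theorem isDeRham_restrictedRationalTateRep_of_etaHasse {K₀ : Type} [Field K₀] [CharZero K₀] [Algebra K₀ F]
    (W₀ : WeierstrassCurve K₀) [W₀.IsElliptic] (W : WeierstrassCurve ℤ) (hW : W₀.baseChange F = AinfTop.curveF F W)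
    (hp5 : 5 ≤ p) (hΔ : ¬ (p : ℤ) ∣ W.Δ) (hA : (W.map (Int.castRingHom (ZMod p))).hasseCoeff p = 0)
    (hlow : ∀ j, j < p → (p : ℤ) ∣ PowerSeries.coeff j (AinfTop.mulDefectInt W p))
    (htop : ¬ (p : ℤ) ∣ PowerSeries.coeff p (AinfTop.mulDefectInt W p)) :
    GaloisRep.IsDeRham (bdRPeriodRingData (F := F) (p := p) hp) (restrictedRationalTateRep W₀ F p) := by
  have hp2 : p ≠ 2 := by omega
  obtain ⟨τ, hτ1, hτp⟩ := AinfTop.exists_tatePt_norm_p_lt_norm_pow F p W hp2 hΔ hA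
  exact isDeRham_restrictedRationalTateRep_of_tatePtPeriods hp W₀ W hW hp2 hΔ hA
    ⟨τ, AinfTop.omegaPeriodHom_ne_zero_of_seq_one_not_mem W hp5 hΔ hA τ
      (AinfTop.not_mem_span_of_norm_p_lt_norm_pow _ hτp)⟩
    ⟨τ, AinfTop.mulDefectC_not_mem_span_of_etaHasse W hlow htop (AinfTop.seq W τ 1)
      (AinfTop.pow_not_mem_span_of_norm_lt _ hτ1 hτp)⟩

end Literature.NumberTheory.PAdicHodge

end
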